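import Mathlib.Algebra.Polynomial.AlgebraMap
import Mathlib.MeasureTheory.MeasurableSpace.Constructions
import Literature.Probability.LatticeModels.RandomCluster
import Literature.Probability.Percolation.Crossings
import Literature.Probability.RandomPlanarGeometry.PlanarDomainsTopology
import HarnessLib

/-!
# Self-dual random-cluster partition polynomials with two wired boundary arcs

Topic: Probability / LatticeModels (notion `fkTwoArcPartitionPolynomials`).

On a finite graph `G = (V, E)` with two distinguished ("boundary") vertex sets `B₁, B₂` we consider
the random-cluster model at the **self-dual point** `p = p_sd(q) = √q / (1 + √q)` of Grimmett,
*The Random-Cluster Model* (2006), §6.1, eq. (6.9). Writing `t = √q`, so that `p / (1 - p) = t` and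
`q = t²`, the random-cluster weight `p^{|ω|} (1 - p)^{|E ∖ ω|} q^{k(ω)}` of an edge set `ω ⊆ E`
(Grimmett 2006, §1.2, eqs. (1.1)–(1.2)) equals `(1 + t)^{-|E|} · t^{|ω| + 2 k(ω)}` (Grimmett 2006,
§6.1, display after (6.9): `φ_{G, p_sd(q), q}(ω) ∝ q^{|η(ω)|/2 + k(ω)}`), so that up to the
configuration-independent factor `(1 + t)^{-|E|}` the partition function is the **generating
polynomial** `Z(t) = Σ_{ω ⊆ E} t^{|ω| + 2 k(ω)}`, a polynomial in `t` with natural-number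
coefficients (coefficient of `t^n` = number of `ω` with `|ω| + 2 k(ω) = n`).

The cluster count `k` depends on the boundary condition. With two boundary arcs there are two
natural wired conditions (Smirnov 2010, §2; Chelkak–Smirnov 2012, §6, Thm. 6.1: conformal
rectangles with wired/free/wired/free sides):

* `ArcWiring.joint`: `B₁ ∪ B₂` wired together (all of `B₁ ∪ B₂` is one cluster),
  `k^{B₁ ∪ B₂}(ω)` = `clusterCount ω (B₁ ∪ B₂)` of `RandomCluster.lean`;
* `ArcWiring.separate`: `B₁` and `B₂` each wired, separately,
  `k^{B₁, B₂}(ω)` = number of components of `openGraph ω ⊔ wired B₁ ⊔ wired B₂`.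

## Main definitions

* `arcWired B₁ B₂ w`, `arcClusterCount ω B₁ B₂ w`: the wiring graph and the cluster count for the
  wiring `w : ArcWiring`; `arcCrossing B₁ B₂`: the event that `B₁` and `B₂` are joined by an open
  path.
* `rcArcPolynomial G B₁ B₂ w = Σ_{ω ⊆ E(G)} X^{|ω| + 2 k^w(ω)} : ℕ[X]` and its restriction
  `rcArcPolynomialIn G U B₁ B₂ w` to configurations in an event `U` (e.g. `U` = a crossing event,
  giving the numerator `N(t)` of a crossing probability).
* For a conformal rectangle `R` (`RandomPlanarGeometry.ConformalRectangle`) and a mesh `δ`, on the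
  discretisation `Ω_δ = domainSubgraph R.carrier δ` (vertex type `↥(meshDomain R.carrier δ)`) with
  the discrete arcs `rectArc R δ 0`, `rectArc R δ 2` of `(ab) = R.arc 0` and `(cd) = R.arc 2`:
  `fkTwoArcPartitionPolynomials R δ w` (`Z^joint_δ`, `Z^sep_δ`) and
  `fkTwoArcCrossingPolynomial R δ w` (`N_δ`, restricted to Smirnov's crossing event
  `Percolation.discreteCrossing R.carrier δ (R.arc 0) (R.arc 2)` pulled back to `Ω_δ`, see
  `rectCrossing`). These are TOTAL in `δ` and instance-free: for `δ > 0` the vertex set is finite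
  (`meshDomain_finite R.isBounded`), and the value does not depend on the `Fintype` instance
  (`fkTwoArcPartitionPolynomials_of_pos`); for `δ ≤ 0` the (documented junk) value is `0`.

## Main statements (all proved)

* `rcWeight_selfDual`, `rcPartitionFunction_selfDual`: at `p = t/(1+t)`, `q = t²` the weights and
  the partition function of `RandomCluster.lean` are `(1+t)^{-|E|}` times the polynomial data.
* `measureReal_rcMeasure`, `measureReal_fkDomainMeasure`: the probability of any event under the
  finite-volume random-cluster measures of `RandomCluster.lean` as an explicit ratio of finite sums;
  `measureReal_rcMeasure_selfDual`: at the self-dual point it is `N(t) / Z^joint(t)`.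
* `discreteArc_union`, `rectArc_zero_union_two`: the discrete arc of `(ab) ∪ (cd)` is the union of
  the discrete arcs of `(ab)` and `(cd)`, so that wiring "the arc `R.arc 0 ∪ R.arc 2`" in
  `fkDomainMeasure` is the joint wiring; whence
  `measureReal_fkDomainMeasure_discreteCrossing`: for `t > 0`,
  `φ^{(ab)∪(cd) wired}_{Ω_δ, t/(1+t), t²}(C_δ) = N_δ(t) / Z^joint_δ(t)`.
* `arcClusterCount_joint_le_separate`, `coeff_rcArcPolynomialIn_le`, `eval_one_rcArcPolynomial`
  (`Z(1) = 2^{|E|}`: at `t = 1`, i.e. `q = 1`, `p = 1/2`, all configurations have weight one).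
* **The joint/separate cluster-count identity** `k^{B₁,B₂}(ω) = k^{B₁∪B₂}(ω) + 1_{B₁ ↮ B₂}(ω)`
  for nonempty `B₁, B₂` on a finite vertex set (`arcClusterCount_separate_eq`; joint wiring merges
  the two separately-wired boundary clusters, which are distinct exactly when no open path joins
  `B₁` to `B₂`: `arcCrossing_of_reachable_separate`, `reachable_joint_iff_separate`), and its
  polynomial form `Z^sep + X²·N = N + X²·Z^joint` (`rcArcPolynomial_separate_add`; at real
  `t > 0`: `Z^joint(t)/Z^sep(t) = P_sep(t) + (1 - P_sep(t))/t²`, `P_sep = N/Z^sep`), with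
  `N^sep = N^joint` (`rcArcPolynomialIn_separate_eq_joint`). Planar forms:
  `mem_rectCrossing_iff` (the pulled-back Smirnov event is the intrinsic crossing event
  `arcCrossing (rectArc R δ 0) (rectArc R δ 2)` on configurations of edges of `Ω_δ`),
  `fkTwoArcCrossingPolynomial_separate_eq_joint`, `fkTwoArcPartitionPolynomials_separate_add`
  (under nonemptiness of the two discrete arcs, which fails for coarse meshes and is kept as a
  hypothesis).

## Design notes

* Coefficients in `ℕ`: evaluate in any commutative semiring `S` (in particular `ℝ`, `ℂ`) with
  `Polynomial.aeval (t : S)`; `aeval_rcArcPolynomial(In)` unfolds this to the finite sum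
  `Σ_ω t^{|ω| + 2k}`.
* The `t → 0⁺` (i.e. `q ↓ 0` along `p = √q/(1+√q)`) regime is the uniform-spanning-tree limit of
  Grimmett 2006, §1.5, Thm. 1.23 (lowest-order coefficients count spanning forests/trees of the
  graph with the arcs contracted); coefficient statements of this kind are NOT made here.
* Not here: zero-free regions, scaling limits, coefficient (spanning-tree/forest) statements,
  nonemptiness of the discrete arcs for small `δ`.

## References

* G. Grimmett, *The Random-Cluster Model*, Springer (2006), §1.2 eqs. (1.1)–(1.2), §1.5 Thm. 1.23,
  §6.1 eq. (6.9).
* S. Smirnov, *Conformal invariance in random cluster models. I*, Ann. Math. 172 (2010), §2.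
* D. Chelkak, S. Smirnov, *Universality in the 2D Ising model and conformal invariance of fermionic
  observables*, Invent. Math. 189 (2012), §6, Thm. 6.1.
-/

namespace Literature.Probability.LatticeModels

open Finset Polynomial
open _root_.MeasureTheory
open scoped Polynomial ENNReal

/-! ### Two wired boundary sets: joint and separate wiring -/

section TwoSets

variable {V : Type*}

/-- The two wired boundary conditions for a pair of boundary arcs `B₁, B₂`: `joint` (the union
`B₁ ∪ B₂` is wired into a single cluster) and `separate` (`B₁` and `B₂` are each wired, into two
a priori different clusters). (Chelkak–Smirnov 2012, §6: the two wired sides of a conformal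
rectangle; Grimmett 2006, §4.2 for wired boundary conditions.) [cite: ChelkakSmirnov2012, §6] -/
inductive ArcWiring : Type
  | /-- `B₁ ∪ B₂` wired together. -/ joint : ArcWiring
  | /-- `B₁` and `B₂` wired separately. -/ separate : ArcWiring
  deriving DecidableEq, Inhabited

/-- The wiring graph of the boundary condition `w` on the arcs `B₁, B₂`: the complete graph on
`B₁ ∪ B₂` (joint wiring), resp. the union of the complete graphs on `B₁` and on `B₂` (separate
wiring), cf. `wired`. (Grimmett 2006, §4.2; Chelkak–Smirnov 2012, §6.) [cite: Grimmett2006, §4.2] -/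
def arcWired (B₁ B₂ : Set V) : ArcWiring → SimpleGraph V
  | .joint => wired (B₁ ∪ B₂)
  | .separate => wired B₁ ⊔ wired B₂

/-- Joint wiring graph, unfolded. [cite: Grimmett2006, §4.2] -/
@[simp] theorem arcWired_joint (B₁ B₂ : Set V) : arcWired B₁ B₂ .joint = wired (B₁ ∪ B₂) := rfl

/-- Separate wiring graph, unfolded. [cite: Grimmett2006, §4.2] -/
@[simp] theorem arcWired_separate (B₁ B₂ : Set V) :
    arcWired B₁ B₂ .separate = wired B₁ ⊔ wired B₂ := rfl

/-- Separate wiring uses fewer wiring edges than joint wiring. [folklore] -/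
theorem arcWired_separate_le_joint (B₁ B₂ : Set V) :
    arcWired B₁ B₂ .separate ≤ arcWired B₁ B₂ .joint := by
  rintro x y (h | h)
  · rw [wired_adj] at h
    rw [arcWired_joint, wired_adj]
    exact ⟨h.1, Or.inl h.2.1, Or.inl h.2.2⟩
  · rw [wired_adj] at h
    rw [arcWired_joint, wired_adj]
    exact ⟨h.1, Or.inr h.2.1, Or.inr h.2.2⟩

/-- The number of open clusters `k^w(ω)` of the configuration `ω` under the wiring `w` of the
arcs `B₁, B₂`: the number of connected components of `openGraph ω ⊔ arcWired B₁ B₂ w`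
(`Nat.card`, junk value `0` if infinite). For `w = joint` this is `clusterCount ω (B₁ ∪ B₂)`.
(Grimmett 2006, §1.2 eq. (1.1) and §4.2.) [cite: Grimmett2006, §1.2 eq. (1.1) and §4.2] -/
noncomputable def arcClusterCount (ω : Percolation.BondConfig V) (B₁ B₂ : Set V)
    (w : ArcWiring) : ℕ :=
  Nat.card (Percolation.openGraph ω ⊔ arcWired B₁ B₂ w).ConnectedComponent

/-- Joint count = the wired cluster count of `RandomCluster.lean` for the wired set `B₁ ∪ B₂`.
[cite: Grimmett2006, §4.2] -/
theorem arcClusterCount_joint (ω : Percolation.BondConfig V) (B₁ B₂ : Set V) :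
    arcClusterCount ω B₁ B₂ .joint = clusterCount ω (B₁ ∪ B₂) := rfl

/-- Separate count, unfolded: components of `openGraph ω ⊔ wired B₁ ⊔ wired B₂`.
[cite: Grimmett2006, §4.2] -/
theorem arcClusterCount_separate (ω : Percolation.BondConfig V) (B₁ B₂ : Set V) :
    arcClusterCount ω B₁ B₂ .separate =
      Nat.card (Percolation.openGraph ω ⊔ wired B₁ ⊔ wired B₂).ConnectedComponent := by
  rw [sup_assoc]; rfl

/-- Joint wiring has at most as many clusters as separate wiring (more wiring edges can only
merge clusters). [folklore] -/
theorem arcClusterCount_joint_le_separate [Finite V] (ω : Percolation.BondConfig V)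
    (B₁ B₂ : Set V) : arcClusterCount ω B₁ B₂ .joint ≤ arcClusterCount ω B₁ B₂ .separate :=
  Nat.card_le_card_of_surjective _ (SimpleGraph.ConnectedComponent.surjective_map_ofLE
    (sup_le_sup_left (arcWired_separate_le_joint B₁ B₂) (Percolation.openGraph ω)))

/-- The crossing event `{B₁ ↔ B₂}`: some vertex of `B₁` is joined to some vertex of `B₂` by an
open path of `ω`. (Chelkak–Smirnov 2012, §6: "an FK cluster crossing between two wired sides";
cf. `Percolation.openCrossing`.) [cite: ChelkakSmirnov2012, §6] -/
def arcCrossing (B₁ B₂ : Set V) : Set (Percolation.BondConfig V) :=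
  {ω | ∃ x ∈ B₁, ∃ y ∈ B₂, (Percolation.openGraph ω).Reachable x y}

/-- Membership in the crossing event, unfolded. [cite: ChelkakSmirnov2012, §6] -/
@[simp] theorem mem_arcCrossing_iff {B₁ B₂ : Set V} {ω : Percolation.BondConfig V} :
    ω ∈ arcCrossing B₁ B₂ ↔ ∃ x ∈ B₁, ∃ y ∈ B₂, (Percolation.openGraph ω).Reachable x y :=
  Iff.rfl

/-- The crossing event is increasing. [folklore] -/
theorem isUpperSet_arcCrossing (B₁ B₂ : Set V) : IsUpperSet (arcCrossing B₁ B₂) := by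
  rintro ω ω' h ⟨x, hx, y, hy, hr⟩
  exact ⟨x, hx, y, hy, hr.mono (Percolation.openGraph_mono h)⟩

/-! ### The generating polynomials of a finite graph -/

variable [Fintype V] (G : SimpleGraph V) [DecidableRel G.Adj]

/-- The self-dual random-cluster generating polynomial of the finite graph `G` with the arcs
`B₁, B₂` wired according to `w`: `Z^w_G(t) = Σ_{ω ⊆ E(G)} t^{|ω| + 2 k^w(ω)} ∈ ℕ[t]`. At
`p = t/(1+t)`, `q = t²` (the self-dual point `p_sd(q) = √q/(1+√q)`, `t = √q`) the random-cluster
partition function (Grimmett 2006, §1.2 eq. (1.2)) is `(1+t)^{-|E|} Z^w_G(t)`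
(`rcPartitionFunction_selfDual`; Grimmett 2006, §6.1, eq. (6.9) and the display following it:
`φ_{p_sd(q),q}(ω) ∝ q^{|η(ω)|/2 + k(ω)}`). [cite: Grimmett2006, §6.1 eq. (6.9)] -/
noncomputable def rcArcPolynomial (B₁ B₂ : Set V) (w : ArcWiring) : ℕ[X] :=
  ∑ ω ∈ G.edgeFinset.powerset,
    X ^ (#ω + 2 * arcClusterCount (↑ω : Percolation.BondConfig V) B₁ B₂ w)

open scoped Classical in
/-- The generating polynomial restricted to an event `U`:
`Σ_{ω ⊆ E(G), ω ∈ U} t^{|ω| + 2 k^w(ω)}`; for `U` a crossing event this is the numerator `N(t)`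
of the crossing probability `N(t)/Z(t)` (`measureReal_rcMeasure_selfDual`). (Grimmett 2006, §1.2
eq. (1.1), §6.1 eq. (6.9).) [cite: Grimmett2006, §1.2 eq. (1.1)] -/
noncomputable def rcArcPolynomialIn (U : Set (Percolation.BondConfig V)) (B₁ B₂ : Set V)
    (w : ArcWiring) : ℕ[X] :=
  ∑ ω ∈ G.edgeFinset.powerset.filter
      (fun ω : Finset (Sym2 V) => (↑ω : Percolation.BondConfig V) ∈ U),
    X ^ (#ω + 2 * arcClusterCount (↑ω : Percolation.BondConfig V) B₁ B₂ w)

/-- Restricting to the sure event gives back `Z`. [folklore] -/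
@[simp] theorem rcArcPolynomialIn_univ (B₁ B₂ : Set V) (w : ArcWiring) :
    rcArcPolynomialIn G Set.univ B₁ B₂ w = rcArcPolynomial G B₁ B₂ w := by
  simp [rcArcPolynomialIn, rcArcPolynomial]

/-- Evaluation of `Z^w_G` at a point `t` of a commutative semiring (e.g. `ℝ`, `ℂ`):
`Z^w_G(t) = Σ_{ω ⊆ E(G)} t^{|ω| + 2 k^w(ω)}`. [cite: Grimmett2006, §6.1 eq. (6.9)] -/
theorem aeval_rcArcPolynomial {S : Type*} [CommSemiring S] (t : S) (B₁ B₂ : Set V)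
    (w : ArcWiring) :
    aeval t (rcArcPolynomial G B₁ B₂ w) = ∑ ω ∈ G.edgeFinset.powerset,
      t ^ (#ω + 2 * arcClusterCount (↑ω : Percolation.BondConfig V) B₁ B₂ w) := by
  simp [rcArcPolynomial, map_sum]

open scoped Classical in
/-- Evaluation of the restricted polynomial: `N^w_{G,U}(t) = Σ_{ω ⊆ E(G), ω ∈ U} t^{|ω| + 2 k^w(ω)}`.
[cite: Grimmett2006, §6.1 eq. (6.9)] -/
theorem aeval_rcArcPolynomialIn {S : Type*} [CommSemiring S] (t : S)
    (U : Set (Percolation.BondConfig V)) (B₁ B₂ : Set V) (w : ArcWiring) :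
    aeval t (rcArcPolynomialIn G U B₁ B₂ w) =
      ∑ ω ∈ G.edgeFinset.powerset.filter
          (fun ω : Finset (Sym2 V) => (↑ω : Percolation.BondConfig V) ∈ U),
        t ^ (#ω + 2 * arcClusterCount (↑ω : Percolation.BondConfig V) B₁ B₂ w) := by
  simp [rcArcPolynomialIn, map_sum]

/-- The coefficients of the restricted polynomial are dominated by those of `Z` (both count
configurations `ω` with `|ω| + 2k^w(ω) = n`, the former only those in `U`). [folklore] -/
theorem coeff_rcArcPolynomialIn_le (U : Set (Percolation.BondConfig V)) (B₁ B₂ : Set V)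
    (w : ArcWiring) (n : ℕ) :
    (rcArcPolynomialIn G U B₁ B₂ w).coeff n ≤ (rcArcPolynomial G B₁ B₂ w).coeff n := by
  classical
  simp only [rcArcPolynomialIn, rcArcPolynomial, finsetSum_coeff]
  exact Finset.sum_le_sum_of_subset_of_nonneg (Finset.filter_subset _ _) fun _ _ _ => Nat.zero_le _

/-- At `t = 1` (i.e. `q = 1`, `p = 1/2`: Bernoulli percolation) every configuration has weight
one: `Z^w_G(1) = 2^{|E(G)|}`. (Grimmett 2006, §1.3: "when q = 1 this is a product measure".)
[cite: Grimmett2006, §1.3] -/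
theorem eval_one_rcArcPolynomial (B₁ B₂ : Set V) (w : ArcWiring) :
    (rcArcPolynomial G B₁ B₂ w).eval 1 = 2 ^ #G.edgeFinset := by
  simp [rcArcPolynomial, eval_finsetSum, Finset.card_powerset]

/-- `Z^w_G ≠ 0`: the empty configuration always contributes (equivalently `Z^w_G(1) = 2^{|E|} ≠ 0`).
[folklore] -/
theorem rcArcPolynomial_ne_zero (B₁ B₂ : Set V) (w : ArcWiring) : rcArcPolynomial G B₁ B₂ w ≠ 0 := by
  intro h
  have h1 := eval_one_rcArcPolynomial G B₁ B₂ w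
  rw [h, eval_zero] at h1
  exact pow_ne_zero _ two_ne_zero h1.symm

variable [DecidableEq V]

/-- **Self-dual weights.** At `p = t/(1+t)`, `q = t²` the random-cluster weight of `ω ⊆ E(G)` is
`(1+t)^{-|E|} t^{|ω| + 2 k(ω)}` (Grimmett 2006, §6.1, display after eq. (6.9)).
[cite: Grimmett2006, §6.1 eq. (6.9)] -/
theorem rcWeight_selfDual {t : ℝ} (ht : 1 + t ≠ 0) (B : Set V) {ω : Finset (Sym2 V)}
    (hω : ω ⊆ G.edgeFinset) :
    rcWeight G (t / (1 + t)) (t ^ 2) B ω =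
      (1 + t)⁻¹ ^ #G.edgeFinset * t ^ (#ω + 2 * clusterCount (↑ω : Percolation.BondConfig V) B) := by
  have h1 : 1 - t / (1 + t) = (1 + t)⁻¹ := by field_simp; ring
  have hE : #(G.edgeFinset \ ω) + #ω = #G.edgeFinset := Finset.card_sdiff_add_card_eq_card hω
  rw [rcWeight, h1, ← hE, div_eq_mul_inv]
  ring

/-- **Self-dual partition function.** `Z_{G, t/(1+t), t²}^{B₁ ∪ B₂} = (1+t)^{-|E|} Z^joint_G(t)`
(Grimmett 2006, §1.2 eq. (1.2) and §6.1 eq. (6.9)). [cite: Grimmett2006, §6.1 eq. (6.9)] -/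
theorem rcPartitionFunction_selfDual {t : ℝ} (ht : 1 + t ≠ 0) (B₁ B₂ : Set V) :
    rcPartitionFunction G (t / (1 + t)) (t ^ 2) (B₁ ∪ B₂) =
      (1 + t)⁻¹ ^ #G.edgeFinset * aeval t (rcArcPolynomial G B₁ B₂ .joint) := by
  rw [rcPartitionFunction, aeval_rcArcPolynomial, Finset.mul_sum]
  refine Finset.sum_congr rfl fun ω hω => ?_
  rw [rcWeight_selfDual G ht _ (Finset.mem_powerset.1 hω), arcClusterCount_joint]

/-- The real mass given to a set `U` by a finite nonnegative combination of Dirac masses.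
[folklore] -/
theorem measureReal_sum_smul_dirac {α ι : Type*} [MeasurableSpace α] [MeasurableSingletonClass α]
    (s : Finset ι) {c : ι → ℝ} (hc : ∀ i ∈ s, 0 ≤ c i) (f : ι → α) (U : Set α)
    [DecidablePred (· ∈ U)] :
    (∑ i ∈ s, ENNReal.ofReal (c i) • Measure.dirac (f i)).real U = ∑ i ∈ s with f i ∈ U, c i := by
  rw [measureReal_def]
  simp only [Measure.coe_finsetSum, Measure.coe_smul, Finset.sum_apply, Pi.smul_apply,
    Measure.dirac_apply, smul_eq_mul]
  rw [ENNReal.toReal_sum (fun i _ => ENNReal.mul_ne_top ENNReal.ofReal_ne_top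
    (by simp only [Set.indicator_apply, Pi.one_apply]; split_ifs <;> simp)), Finset.sum_filter]
  refine Finset.sum_congr rfl fun i hi => ?_
  by_cases h : f i ∈ U
  · simp [h, ENNReal.toReal_ofReal (hc i hi)]
  · simp [h]

/-- **Probabilities under `rcMeasure` as ratios of finite sums**: for `0 ≤ p ≤ 1`, `0 < q`,
`φ^B_{G,p,q}(U) = (Σ_{ω ⊆ E(G), ω ∈ U} w(ω)) / Z` (Grimmett 2006, §1.2 eq. (1.1)).
[cite: Grimmett2006, §1.2 eq. (1.1)] -/
theorem measureReal_rcMeasure {p q : ℝ} (hp : p ∈ Set.Icc (0 : ℝ) 1) (hq : 0 < q) (B : Set V)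
    (U : Set (Percolation.BondConfig V)) [DecidablePred (· ∈ U)] :
    (rcMeasure G p q B).real U =
      (∑ ω ∈ G.edgeFinset.powerset.filter
          (fun ω : Finset (Sym2 V) => (↑ω : Percolation.BondConfig V) ∈ U), rcWeight G p q B ω) /
        rcPartitionFunction G p q B := by
  have hZ := rcPartitionFunction_pos G hp hq B
  rw [rcMeasure, measureReal_sum_smul_dirac _
    (fun ω _ => div_nonneg (rcWeight_nonneg G hp hq.le B ω) hZ.le), Finset.sum_div]

/-- **Crossing-type probabilities at the self-dual point are ratios of the generating
polynomials**: for `t > 0` and any event `U`,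
`φ^{B₁ ∪ B₂}_{G, t/(1+t), t²}(U) = N^joint_{G,U}(t) / Z^joint_G(t)` (the common factor
`(1+t)^{-|E|}` cancels). (Grimmett 2006, §1.2 eq. (1.1), §6.1 eq. (6.9).)
[cite: Grimmett2006, §6.1 eq. (6.9)] -/
theorem measureReal_rcMeasure_selfDual {t : ℝ} (ht : 0 < t) (B₁ B₂ : Set V)
    (U : Set (Percolation.BondConfig V)) :
    (rcMeasure G (t / (1 + t)) (t ^ 2) (B₁ ∪ B₂)).real U =
      aeval t (rcArcPolynomialIn G U B₁ B₂ .joint) / aeval t (rcArcPolynomial G B₁ B₂ .joint) := by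
  classical
  have h1t : 1 + t ≠ 0 := by positivity
  have hp : t / (1 + t) ∈ Set.Icc (0 : ℝ) 1 :=
    ⟨div_nonneg ht.le (by positivity), (div_le_one (by positivity)).2 (by linarith)⟩
  have hc : (1 + t)⁻¹ ^ #G.edgeFinset ≠ 0 := pow_ne_zero _ (inv_ne_zero h1t)
  rw [measureReal_rcMeasure G hp (by positivity), rcPartitionFunction_selfDual G h1t,
    aeval_rcArcPolynomialIn]
  have hnum : (∑ ω ∈ G.edgeFinset.powerset.filter
      (fun ω : Finset (Sym2 V) => (↑ω : Percolation.BondConfig V) ∈ U),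
        rcWeight G (t / (1 + t)) (t ^ 2) (B₁ ∪ B₂) ω) =
      (1 + t)⁻¹ ^ #G.edgeFinset * ∑ ω ∈ G.edgeFinset.powerset.filter
          (fun ω : Finset (Sym2 V) => (↑ω : Percolation.BondConfig V) ∈ U),
        t ^ (#ω + 2 * arcClusterCount (↑ω : Percolation.BondConfig V) B₁ B₂ .joint) := by
    rw [Finset.mul_sum]
    refine Finset.sum_congr rfl fun ω hω => ?_
    rw [rcWeight_selfDual G h1t _ (Finset.mem_powerset.1 (Finset.mem_filter.1 hω).1),
      arcClusterCount_joint]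
  rw [hnum, mul_div_mul_left _ _ hc]

end TwoSets

/-! ### Discrete arcs of a union of boundary arcs -/

section Arcs

/-- `infDist` to a union of two nonempty sets is the minimum of the two distances. [folklore] -/
theorem infDist_union {α : Type*} [PseudoMetricSpace α] (x : α) {s t : Set α} (hs : s.Nonempty)
    (ht : t.Nonempty) :
    Metric.infDist x (s ∪ t) = min (Metric.infDist x s) (Metric.infDist x t) := by
  simp only [Metric.infDist, Metric.infEDist_union]
  exact ENNReal.toReal_min (Metric.infEDist_ne_top hs) (Metric.infEDist_ne_top ht)

/-- **The discrete arc of a union is the union of the discrete arcs**: for nonempty boundary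
arcs `A, B` leaving out a nonempty part of `∂Ω`, a boundary vertex is at least as close to
`A ∪ B` as to the rest of `∂Ω` iff it is so for `A` or for `B` (Smirnov 2001, §2: discrete arcs
are the boundary vertices closest to the arc). [cite: Smirnov2001, §2] -/
theorem discreteArc_union {Ω : Set ℂ} {δ : ℝ} {A B : Set ℂ} (hA : A.Nonempty) (hB : B.Nonempty)
    (hF : (frontier Ω \ (A ∪ B)).Nonempty) :
    discreteArc Ω δ (A ∪ B) = discreteArc Ω δ A ∪ discreteArc Ω δ B := by
  ext x
  simp only [Set.mem_union, mem_discreteArc_iff]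
  set z := meshPoint δ x
  set F := frontier Ω
  have hU : Metric.infDist z (A ∪ B) = min (Metric.infDist z A) (Metric.infDist z B) :=
    infDist_union z hA hB
  have hsA : F \ (A ∪ B) ⊆ F \ A := Set.sdiff_subset_sdiff_right Set.subset_union_left
  have hsB : F \ (A ∪ B) ⊆ F \ B := Set.sdiff_subset_sdiff_right Set.subset_union_right
  have hFA : Metric.infDist z (F \ A) ≤ Metric.infDist z (F \ (A ∪ B)) :=
    Metric.infDist_le_infDist_of_subset hsA hF
  have hFB : Metric.infDist z (F \ B) ≤ Metric.infDist z (F \ (A ∪ B)) :=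
    Metric.infDist_le_infDist_of_subset hsB hF
  have hFA' : min (Metric.infDist z B) (Metric.infDist z (F \ (A ∪ B))) ≤
      Metric.infDist z (F \ A) := by
    rw [← infDist_union z hB hF]
    refine Metric.infDist_le_infDist_of_subset (fun y hy => ?_) (hF.mono hsA)
    by_cases hyB : y ∈ B
    · exact Or.inl hyB
    · exact Or.inr ⟨hy.1, fun h => h.elim hy.2 hyB⟩
  have hFB' : min (Metric.infDist z A) (Metric.infDist z (F \ (A ∪ B))) ≤
      Metric.infDist z (F \ B) := by
    rw [← infDist_union z hA hF]
    refine Metric.infDist_le_infDist_of_subset (fun y hy => ?_) (hF.mono hsB)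
    by_cases hyA : y ∈ A
    · exact Or.inl hyA
    · exact Or.inr ⟨hy.1, fun h => h.elim hyA hy.2⟩
  constructor
  · rintro ⟨hx, h⟩
    rw [hU] at h
    rcases le_total (Metric.infDist z A) (Metric.infDist z B) with hab | hab
    · rw [min_eq_left hab] at h
      exact Or.inl ⟨hx, (le_min hab h).trans hFA'⟩
    · rw [min_eq_right hab] at h
      exact Or.inr ⟨hx, (le_min hab h).trans hFB'⟩
  · rintro (⟨hx, h⟩ | ⟨hx, h⟩)
    · exact ⟨hx, hU ▸ (min_le_left _ _).trans (h.trans hFA)⟩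
    · exact ⟨hx, hU ▸ (min_le_right _ _).trans (h.trans hFB)⟩

end Arcs

/-! ### The two-arc polynomials of a discretised conformal rectangle -/

section Planar

open RandomPlanarGeometry

variable (R : ConformalRectangle) (δ : ℝ)

/-- A conformal rectangle has boundary points off the two arcs `(ab) = R.arc 0` and
`(cd) = R.arc 2` (e.g. the midpoint of the arc `(bc)`). [folklore] -/
theorem frontier_diff_arc_zero_union_two_nonempty :
    (frontier R.carrier \ (R.arc 0 ∪ R.arc 2)).Nonempty := by
  refine ⟨R.boundary ((R.mark 1 + R.nextMark 1) / 2), R.boundary_mem_frontier _, ?_⟩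
  rintro (h | h)
  · exact R.boundary_not_mem_arc (i := 1) (j := 0) (by decide) (R.midpoint_mem_Ioo 1) h
  · exact R.boundary_not_mem_arc (i := 1) (j := 2) (by decide) (R.midpoint_mem_Ioo 1) h

/-- The discrete boundary arc of `R.arc i` in the discretised domain `Ω_δ`, as a set of vertices
of the finite vertex type `↥(meshDomain R.carrier δ)` of `domainSubgraph R.carrier δ`:
the preimage of `discreteArc R.carrier δ (R.arc i)`. (Smirnov 2001, §2; Smirnov 2010, §2.)
[cite: Smirnov2001, §2] -/
def rectArc (i : Fin 4) : Set (meshDomain R.carrier δ) :=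
  Subtype.val ⁻¹' discreteArc R.carrier δ (R.arc i)

/-- Membership in `rectArc`, unfolded. [cite: Smirnov2001, §2] -/
@[simp] theorem mem_rectArc_iff {i : Fin 4} {x : meshDomain R.carrier δ} :
    x ∈ rectArc R δ i ↔ (x : Site 2) ∈ discreteArc R.carrier δ (R.arc i) := Iff.rfl

/-- **Joint wiring = wiring the union of the arcs**: the union of the discrete arcs of `(ab)` and
`(cd)` is the discrete arc of `(ab) ∪ (cd)`, i.e. the set wired by
`fkDomainMeasure R.carrier δ p q (R.arc 0 ∪ R.arc 2)`. [cite: Smirnov2001, §2] -/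
theorem rectArc_zero_union_two :
    rectArc R δ 0 ∪ rectArc R δ 2 =
      Subtype.val ⁻¹' discreteArc R.carrier δ (R.arc 0 ∪ R.arc 2) := by
  rw [rectArc, rectArc, ← Set.preimage_union, discreteArc_union ⟨_, R.pt_mem_arc_self 0⟩
    ⟨_, R.pt_mem_arc_self 2⟩ (frontier_diff_arc_zero_union_two_nonempty R)]

/-- Smirnov's crossing event `C_δ(Ω; (ab), (cd)) = discreteCrossing R.carrier δ (R.arc 0) (R.arc 2)`
pulled back to bond configurations of the vertex type `↥(meshDomain R.carrier δ)` along the lift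
`ω ↦ Sym2.map Subtype.val '' ω` (= `liftConfig` on finite configurations). (Smirnov 2001, §2.)
[cite: Smirnov2001, §2] -/
def rectCrossing : Set (Percolation.BondConfig (meshDomain R.carrier δ)) :=
  {ω | Sym2.map Subtype.val '' ω ∈ Percolation.discreteCrossing R.carrier δ (R.arc 0) (R.arc 2)}

/-- A finite configuration of `Ω_δ` is in `rectCrossing` iff its lift `liftConfig` is in
Smirnov's crossing event. [cite: Smirnov2001, §2] -/
@[simp] theorem coe_mem_rectCrossing_iff {ω : Finset (Sym2 (meshDomain R.carrier δ))} :
    (↑ω : Percolation.BondConfig (meshDomain R.carrier δ)) ∈ rectCrossing R δ ↔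
      liftConfig R.carrier δ ω ∈ Percolation.discreteCrossing R.carrier δ (R.arc 0) (R.arc 2) :=
  Iff.rfl

open scoped Classical in
/-- **The two-arc partition polynomials** `Z^joint_δ(t)`, `Z^sep_δ(t)` of the conformal rectangle
`R` at mesh `δ`: the self-dual random-cluster generating polynomials
`Σ_{ω ⊆ E(Ω_δ)} t^{|ω| + 2 k^w(ω)} ∈ ℕ[t]` of the discretised domain
`Ω_δ = domainSubgraph R.carrier δ` with the discrete arcs of `(ab) = R.arc 0` and `(cd) = R.arc 2`
wired jointly (`w = joint`) or separately (`w = separate`). Total in `δ`: for `δ > 0` the vertex set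
`meshDomain R.carrier δ` is finite (`meshDomain_finite R.isBounded`); for `δ ≤ 0` the junk value
is `0`. (Grimmett 2006, §1.2 eq. (1.2), §6.1 eq. (6.9); Chelkak–Smirnov 2012, §6.)
[cite: Grimmett2006, §6.1 eq. (6.9)] -/
noncomputable def fkTwoArcPartitionPolynomials (w : ArcWiring) : ℕ[X] :=
  if hδ : 0 < δ then
    letI : Fintype (meshDomain R.carrier δ) := (meshDomain_finite R.isBounded hδ).fintype
    rcArcPolynomial (domainSubgraph R.carrier δ) (rectArc R δ 0) (rectArc R δ 2) w
  else 0

open scoped Classical in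
/-- **The two-arc crossing polynomial** `N_δ(t)`: the self-dual generating polynomial of `Ω_δ`
restricted to the configurations whose lift crosses from the discrete arc of `(ab)` to that of
`(cd)` (event `Percolation.discreteCrossing R.carrier δ (R.arc 0) (R.arc 2)`), with wiring `w`.
Junk value `0` for `δ ≤ 0`. (Smirnov 2001, §2; Chelkak–Smirnov 2012, §6, Thm. 6.1.)
[cite: ChelkakSmirnov2012, §6 Thm. 6.1] -/
noncomputable def fkTwoArcCrossingPolynomial (w : ArcWiring) : ℕ[X] :=
  if hδ : 0 < δ then
    letI : Fintype (meshDomain R.carrier δ) := (meshDomain_finite R.isBounded hδ).fintype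
    rcArcPolynomialIn (domainSubgraph R.carrier δ) (rectCrossing R δ) (rectArc R δ 0)
      (rectArc R δ 2) w
  else 0

variable {δ}

open scoped Classical in
/-- For `δ > 0`, `fkTwoArcPartitionPolynomials` is the generic polynomial of `Ω_δ`, for ANY
`Fintype` instance on the vertex set. [cite: Grimmett2006, §6.1 eq. (6.9)] -/
theorem fkTwoArcPartitionPolynomials_of_pos (hδ : 0 < δ) [Fintype (meshDomain R.carrier δ)]
    (w : ArcWiring) :
    fkTwoArcPartitionPolynomials R δ w =
      rcArcPolynomial (domainSubgraph R.carrier δ) (rectArc R δ 0) (rectArc R δ 2) w := by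
  rw [fkTwoArcPartitionPolynomials, dif_pos hδ]
  congr!

open scoped Classical in
/-- For `δ > 0`, `fkTwoArcCrossingPolynomial` is the generic restricted polynomial of `Ω_δ`, for
ANY `Fintype` instance on the vertex set. [cite: ChelkakSmirnov2012, §6 Thm. 6.1] -/
theorem fkTwoArcCrossingPolynomial_of_pos (hδ : 0 < δ) [Fintype (meshDomain R.carrier δ)]
    (w : ArcWiring) :
    fkTwoArcCrossingPolynomial R δ w =
      rcArcPolynomialIn (domainSubgraph R.carrier δ) (rectCrossing R δ) (rectArc R δ 0)
        (rectArc R δ 2) w := by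
  rw [fkTwoArcCrossingPolynomial, dif_pos hδ]
  congr!

/-- Junk value for `δ ≤ 0`. [folklore] -/
theorem fkTwoArcPartitionPolynomials_of_nonpos (hδ : δ ≤ 0) (w : ArcWiring) :
    fkTwoArcPartitionPolynomials R δ w = 0 := by
  rw [fkTwoArcPartitionPolynomials, dif_neg (not_lt.2 hδ)]

/-- Junk value for `δ ≤ 0`. [folklore] -/
theorem fkTwoArcCrossingPolynomial_of_nonpos (hδ : δ ≤ 0) (w : ArcWiring) :
    fkTwoArcCrossingPolynomial R δ w = 0 := by
  rw [fkTwoArcCrossingPolynomial, dif_neg (not_lt.2 hδ)]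

/-- `N_δ ≤ Z_δ` coefficientwise. [folklore] -/
theorem coeff_fkTwoArcCrossingPolynomial_le (w : ArcWiring) (n : ℕ) :
    (fkTwoArcCrossingPolynomial R δ w).coeff n ≤ (fkTwoArcPartitionPolynomials R δ w).coeff n := by
  classical
  rcases le_or_gt δ 0 with hδ | hδ
  · simp [fkTwoArcCrossingPolynomial_of_nonpos R hδ, fkTwoArcPartitionPolynomials_of_nonpos R hδ]
  · letI : Fintype (meshDomain R.carrier δ) := (meshDomain_finite R.isBounded hδ).fintype
    rw [fkTwoArcCrossingPolynomial_of_pos R hδ, fkTwoArcPartitionPolynomials_of_pos R hδ]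
    exact coeff_rcArcPolynomialIn_le _ _ _ _ _ _

open scoped Classical in
/-- At `t = 1` (Bernoulli percolation at `p = 1/2`): `Z_δ(1) = 2^{|E(Ω_δ)|}` for `δ > 0`.
[cite: Grimmett2006, §1.3] -/
theorem eval_one_fkTwoArcPartitionPolynomials (hδ : 0 < δ) [Fintype (meshDomain R.carrier δ)]
    (w : ArcWiring) :
    (fkTwoArcPartitionPolynomials R δ w).eval 1 = 2 ^ #(domainSubgraph R.carrier δ).edgeFinset := by
  rw [fkTwoArcPartitionPolynomials_of_pos R hδ, eval_one_rcArcPolynomial]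

/-- For `δ > 0` the partition polynomials are nonzero (the empty configuration contributes), so
`N_δ(t)/Z_δ(t)` is a genuine quotient wherever `Z_δ(t) ≠ 0`. [folklore] -/
theorem fkTwoArcPartitionPolynomials_ne_zero (hδ : 0 < δ) (w : ArcWiring) :
    fkTwoArcPartitionPolynomials R δ w ≠ 0 := by
  classical
  letI : Fintype (meshDomain R.carrier δ) := (meshDomain_finite R.isBounded hδ).fintype
  rw [fkTwoArcPartitionPolynomials_of_pos R hδ]
  exact rcArcPolynomial_ne_zero _ _ _ _

open scoped Classical in
/-- **Probabilities under `fkDomainMeasure` as ratios of finite sums**: for `0 ≤ p ≤ 1`,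
`0 < q`, the mass of an event `U ⊆ BondConfig (Site 2)` is
`(Σ_{ω ⊆ E(Ω_δ), ι(ω) ∈ U} w(ω)) / Z`, `ι = liftConfig`. (Grimmett 2006, §1.2 eq. (1.1);
Smirnov 2010, §2.) [cite: Grimmett2006, §1.2 eq. (1.1)] -/
theorem measureReal_fkDomainMeasure (Ω : Set ℂ) (δ : ℝ) {p q : ℝ} (hp : p ∈ Set.Icc (0 : ℝ) 1)
    (hq : 0 < q) (A : Set ℂ) [Fintype (meshDomain Ω δ)]
    (U : Set (Percolation.BondConfig (Site 2))) :
    (fkDomainMeasure Ω δ p q A).real U =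
      (∑ ω ∈ (domainSubgraph Ω δ).edgeFinset.powerset with liftConfig Ω δ ω ∈ U,
          rcWeight (domainSubgraph Ω δ) p q (Subtype.val ⁻¹' discreteArc Ω δ A) ω) /
        rcPartitionFunction (domainSubgraph Ω δ) p q (Subtype.val ⁻¹' discreteArc Ω δ A) := by
  have hZ := rcPartitionFunction_pos (domainSubgraph Ω δ) hp hq
    (Subtype.val ⁻¹' discreteArc Ω δ A)
  rw [fkDomainMeasure, measureReal_sum_smul_dirac _
    (fun ω _ => div_nonneg (rcWeight_nonneg _ hp hq.le _ ω) hZ.le), Finset.sum_div]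

/-- **The self-dual two-arc crossing probability is `N_δ / Z^joint_δ`.** For `δ > 0` and
`t > 0`, the `fkDomainMeasure` of `RandomCluster.lean` at `p = t/(1+t)`, `q = t²`, wired on the
discrete arc of `(ab) ∪ (cd)`, gives Smirnov's crossing event `C_δ(Ω; (ab), (cd))` the mass
`N_δ(t) / Z^joint_δ(t)`. (Grimmett 2006, §6.1 eq. (6.9); Chelkak–Smirnov 2012, §6, Thm. 6.1 is
the statement that this quantity converges at `t = √2`.) [cite: Grimmett2006, §6.1 eq. (6.9)] -/
theorem measureReal_fkDomainMeasure_discreteCrossing (hδ : 0 < δ) {t : ℝ} (ht : 0 < t)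
    [Fintype (meshDomain R.carrier δ)] :
    (fkDomainMeasure R.carrier δ (t / (1 + t)) (t ^ 2) (R.arc 0 ∪ R.arc 2)).real
        (Percolation.discreteCrossing R.carrier δ (R.arc 0) (R.arc 2)) =
      aeval t (fkTwoArcCrossingPolynomial R δ .joint) /
        aeval t (fkTwoArcPartitionPolynomials R δ .joint) := by
  classical
  have h1t : 1 + t ≠ 0 := by positivity
  have hp : t / (1 + t) ∈ Set.Icc (0 : ℝ) 1 :=
    ⟨div_nonneg ht.le (by positivity), (div_le_one (by positivity)).2 (by linarith)⟩
  have hc : (1 + t)⁻¹ ^ #(domainSubgraph R.carrier δ).edgeFinset ≠ 0 :=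
    pow_ne_zero _ (inv_ne_zero h1t)
  rw [measureReal_fkDomainMeasure _ _ hp (by positivity), ← rectArc_zero_union_two,
    rcPartitionFunction_selfDual _ h1t, fkTwoArcCrossingPolynomial_of_pos R hδ,
    fkTwoArcPartitionPolynomials_of_pos R hδ, aeval_rcArcPolynomialIn]
  have hnum : (∑ ω ∈ (domainSubgraph R.carrier δ).edgeFinset.powerset with
        liftConfig R.carrier δ ω ∈ Percolation.discreteCrossing R.carrier δ (R.arc 0) (R.arc 2),
        rcWeight (domainSubgraph R.carrier δ) (t / (1 + t)) (t ^ 2)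
          (rectArc R δ 0 ∪ rectArc R δ 2) ω) =
      (1 + t)⁻¹ ^ #(domainSubgraph R.carrier δ).edgeFinset *
        ∑ ω ∈ (domainSubgraph R.carrier δ).edgeFinset.powerset.filter
            (fun ω : Finset (Sym2 (meshDomain R.carrier δ)) =>
              (↑ω : Percolation.BondConfig (meshDomain R.carrier δ)) ∈ rectCrossing R δ),
          t ^ (#ω + 2 * arcClusterCount (↑ω : Percolation.BondConfig (meshDomain R.carrier δ))
            (rectArc R δ 0) (rectArc R δ 2) .joint) := by
    rw [Finset.mul_sum]
    refine Finset.sum_congr (by ext ω; simp) fun ω hω => ?_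
    rw [rcWeight_selfDual _ h1t _ (Finset.mem_powerset.1 (Finset.mem_filter.1 hω).1),
      arcClusterCount_joint]
  rw [hnum, mul_div_mul_left _ _ hc]

end Planar

/-! ### The joint/separate cluster-count identity -/

section ClusterCountIdentity

open SimpleGraph

variable {V : Type*}

/-- Reachability is the least reflexive–transitive relation containing adjacency: a reflexive and
transitive relation containing the edges of `H` contains `H`-reachability. [folklore] -/
theorem reachable_le_of_adj_le {H : SimpleGraph V} {r : V → V → Prop} (hrefl : ∀ x, r x x)
    (htrans : ∀ x y z, r x y → r y z → r x z) (hadj : ∀ x y, H.Adj x y → r x y) {u v : V}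
    (h : H.Reachable u v) : r u v := by
  obtain ⟨p⟩ := h
  induction p with
  | nil => exact hrefl _
  | cons ha _ ih => exact htrans _ _ _ (hadj _ _ ha) ih

/-- Two vertices of a wired set are joined in the wiring graph. [cite: Grimmett2006, §4.2] -/
theorem reachable_wired {B : Set V} {x y : V} (hx : x ∈ B) (hy : y ∈ B) :
    (wired B).Reachable x y := by
  by_cases h : x = y
  · subst h; rfl
  · exact ((wired_adj B x y).2 ⟨h, hx, hy⟩).reachable

/-- **A separately-wired connection between the arcs contains an open crossing.** If `a ∈ B₁`
and `c ∈ B₂` are joined in `openGraph ω ⊔ wired B₁ ⊔ wired B₂`, then some vertex of `B₁` is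
joined to some vertex of `B₂` by an open path of `ω` alone (follow the walk from its last use of
the wiring of `B₁` to its first use of the wiring of `B₂`). [folklore] -/
theorem arcCrossing_of_reachable_separate {ω : Percolation.BondConfig V} {B₁ B₂ : Set V}
    {a c : V} (ha : a ∈ B₁) (hc : c ∈ B₂)
    (h : (Percolation.openGraph ω ⊔ arcWired B₁ B₂ .separate).Reachable a c) :
    ω ∈ arcCrossing B₁ B₂ := by
  obtain ⟨p⟩ := h
  suffices H : ∀ {u v : V} (_ : (Percolation.openGraph ω ⊔ arcWired B₁ B₂ .separate).Walk u v),
      v ∈ B₂ → ∀ x ∈ B₁, (Percolation.openGraph ω).Reachable x u → ω ∈ arcCrossing B₁ B₂ from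
    H p hc a ha Reachable.rfl
  intro u v p
  induction p with
  | nil => exact fun hu x hx hxu => ⟨x, hx, _, hu, hxu⟩
  | cons hadj _ ih =>
    intro hv x hx hxu
    rcases hadj with hadj | hadj | hadj
    · exact ih hv x hx (hxu.trans hadj.reachable)
    · rw [wired_adj] at hadj
      exact ih hv _ hadj.2.2 Reachable.rfl
    · rw [wired_adj] at hadj
      exact ⟨x, hx, _, hadj.2.1, hxu⟩

/-- With a crossing present, joint adjacency is separately-wired reachability: an extra wiring
edge from `x ∈ B₁` to `y ∈ B₂` is replaced by `x ⇝ a ↝ c ⇝ y` through the open crossing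
`a ↝ c`. [folklore] -/
theorem reachable_separate_of_adj_joint {ω : Percolation.BondConfig V} {B₁ B₂ : Set V}
    (hω : ω ∈ arcCrossing B₁ B₂) {x y : V}
    (h : (Percolation.openGraph ω ⊔ arcWired B₁ B₂ .joint).Adj x y) :
    (Percolation.openGraph ω ⊔ arcWired B₁ B₂ .separate).Reachable x y := by
  obtain ⟨a, ha, c, hc, hac⟩ := hω
  have hO : Percolation.openGraph ω ≤ Percolation.openGraph ω ⊔ arcWired B₁ B₂ .separate :=
    le_sup_left
  have h₁ : wired B₁ ≤ Percolation.openGraph ω ⊔ arcWired B₁ B₂ .separate :=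
    le_sup_left.trans le_sup_right
  have h₂ : wired B₂ ≤ Percolation.openGraph ω ⊔ arcWired B₁ B₂ .separate :=
    le_sup_right.trans le_sup_right
  rcases h with h | h
  · exact (hO h).reachable
  · rw [arcWired_joint, wired_adj] at h
    obtain ⟨-, hx | hx, hy | hy⟩ := h
    · exact (reachable_wired hx hy).mono h₁
    · exact (((reachable_wired hx ha).mono h₁).trans ((hac.mono hO).trans
        ((reachable_wired hc hy).mono h₂)))
    · exact (((reachable_wired hx hc).mono h₂).trans ((hac.symm.mono hO).trans
        ((reachable_wired ha hy).mono h₁)))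
    · exact (reachable_wired hx hy).mono h₂

/-- With a crossing present, joint and separate wiring have the same connectivity. [folklore] -/
theorem reachable_joint_iff_separate {ω : Percolation.BondConfig V} {B₁ B₂ : Set V}
    (hω : ω ∈ arcCrossing B₁ B₂) {x y : V} :
    (Percolation.openGraph ω ⊔ arcWired B₁ B₂ .joint).Reachable x y ↔
      (Percolation.openGraph ω ⊔ arcWired B₁ B₂ .separate).Reachable x y :=
  ⟨reachable_le_of_adj_le (r := (Percolation.openGraph ω ⊔ arcWired B₁ B₂ .separate).Reachable)
      (fun _ => Reachable.rfl) (fun _ _ _ => Reachable.trans)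
      (fun _ _ => reachable_separate_of_adj_joint hω),
    Reachable.mono (sup_le_sup_left (arcWired_separate_le_joint B₁ B₂) _)⟩

/-- **Cluster counts agree on crossing configurations**: if `B₁` and `B₂` are joined by an open
path then `k^{B₁,B₂}(ω) = k^{B₁ ∪ B₂}(ω)` (the two wired clusters are already one cluster).
[folklore] -/
theorem arcClusterCount_separate_eq_joint_of_mem {ω : Percolation.BondConfig V} {B₁ B₂ : Set V}
    (hω : ω ∈ arcCrossing B₁ B₂) :
    arcClusterCount ω B₁ B₂ .separate = arcClusterCount ω B₁ B₂ .joint := by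
  have hle : Percolation.openGraph ω ⊔ arcWired B₁ B₂ .separate ≤
      Percolation.openGraph ω ⊔ arcWired B₁ B₂ .joint :=
    sup_le_sup_left (arcWired_separate_le_joint B₁ B₂) _
  refine Nat.card_congr (Equiv.ofBijective (ConnectedComponent.map (Hom.ofLE hle))
    ⟨?_, ConnectedComponent.surjective_map_ofLE hle⟩)
  refine ConnectedComponent.ind₂ fun u v huv => ?_
  simp only [ConnectedComponent.map_mk, Hom.coe_ofLE, id_eq, ConnectedComponent.eq] at huv
  exact ConnectedComponent.sound ((reachable_joint_iff_separate hω).1 huv)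

/-- **Cluster counts differ by one off crossing configurations**: if `B₁, B₂` are nonempty and NOT
joined by an open path then `k^{B₁,B₂}(ω) = k^{B₁ ∪ B₂}(ω) + 1` on a finite graph (joint wiring
merges exactly the two distinct wired clusters). [folklore] -/
theorem arcClusterCount_separate_eq_joint_add_one_of_not_mem [Finite V]
    {ω : Percolation.BondConfig V} {B₁ B₂ : Set V} {a c : V} (ha : a ∈ B₁) (hc : c ∈ B₂)
    (hω : ω ∉ arcCrossing B₁ B₂) :
    arcClusterCount ω B₁ B₂ .separate = arcClusterCount ω B₁ B₂ .joint + 1 := by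
  classical
  set Gs := Percolation.openGraph ω ⊔ arcWired B₁ B₂ .separate
  set Gj := Percolation.openGraph ω ⊔ arcWired B₁ B₂ .joint
  have hle : Gs ≤ Gj := sup_le_sup_left (arcWired_separate_le_joint B₁ B₂) _
  set φ : Gs.ConnectedComponent → Gj.ConnectedComponent := ConnectedComponent.map (Hom.ofLE hle)
    with hφdef
  have hφ : Function.Surjective φ := ConnectedComponent.surjective_map_ofLE hle
  set c₁ := Gs.connectedComponentMk a with hc₁
  set c₂ := Gs.connectedComponentMk c with hc₂
  have h₁ : wired B₁ ≤ Gs := le_sup_left.trans le_sup_right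
  have h₂ : wired B₂ ≤ Gs := le_sup_right.trans le_sup_right
  have hne : c₁ ≠ c₂ := fun h =>
    hω (arcCrossing_of_reachable_separate ha hc (ConnectedComponent.exact h))
  have hB₁ : ∀ u ∈ B₁, Gs.connectedComponentMk u = c₁ := fun u hu =>
    ConnectedComponent.sound ((reachable_wired hu ha).mono h₁)
  have hB₂ : ∀ u ∈ B₂, Gs.connectedComponentMk u = c₂ := fun u hu =>
    ConnectedComponent.sound ((reachable_wired hu hc).mono h₂)
  have hφ₁₂ : φ c₁ = φ c₂ := by
    simp only [hc₁, hc₂, hφdef, ConnectedComponent.map_mk, Hom.coe_ofLE, id_eq,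
      ConnectedComponent.eq]
    exact (reachable_wired (B := B₁ ∪ B₂) (Or.inl ha) (Or.inr hc)).mono le_sup_right
  -- `ψ` merges `c₂` into `c₁`
  set ψ : Gs.ConnectedComponent → Gs.ConnectedComponent := fun d => if d = c₂ then c₁ else d
    with hψdef
  have hφψ : ∀ d, φ (ψ d) = φ d := fun d => by
    by_cases hd : d = c₂
    · simp only [hψdef, hd, if_true, hφ₁₂]
    · simp only [hψdef, hd, if_false]
  have hψB : ∀ u, u ∈ B₁ ∪ B₂ → ψ (Gs.connectedComponentMk u) = c₁ := by
    rintro u (hu | hu)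
    · simp only [hψdef, hB₁ u hu, ite_self]
    · simp only [hψdef, hB₂ u hu, if_true]
  have key : ∀ u v, Gj.Reachable u v →
      ψ (Gs.connectedComponentMk u) = ψ (Gs.connectedComponentMk v) := by
    intro u v huv
    refine reachable_le_of_adj_le
      (r := fun u v => ψ (Gs.connectedComponentMk u) = ψ (Gs.connectedComponentMk v))
      (fun _ => rfl) (fun _ _ _ h1 h2 => h1.trans h2) ?_ huv
    rintro x y (hxy | hxy)
    · rw [ConnectedComponent.sound ((le_sup_left : Percolation.openGraph ω ≤ Gs) hxy).reachable]
    · rw [arcWired_joint, wired_adj] at hxy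
      rw [hψB x hxy.2.1, hψB y hxy.2.2]
  have hinj : ∀ d d', φ d = φ d' → ψ d = ψ d' := by
    refine ConnectedComponent.ind₂ fun u v huv => ?_
    apply key
    simpa only [hφdef, ConnectedComponent.map_mk, Hom.coe_ofLE, id_eq,
      ConnectedComponent.eq] using huv
  have hψne : ∀ d, ψ d ≠ c₂ := fun d => by
    change (if d = c₂ then c₁ else d) ≠ c₂
    by_cases hd : d = c₂
    · rw [if_pos hd]; exact hne
    · rw [if_neg hd]; exact hd
  -- `Gj`-components ≃ `Gs`-components other than `c₂`
  let e : Gj.ConnectedComponent ≃ {d : Gs.ConnectedComponent // d ≠ c₂} :=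
    { toFun := fun q => ⟨ψ (Function.surjInv hφ q), hψne _⟩
      invFun := fun d => φ d.1
      left_inv := fun q => by simp only; rw [hφψ, Function.surjInv_eq hφ]
      right_inv := fun d => by
        ext
        simp only
        rw [hinj _ _ (Function.surjInv_eq hφ (φ d.1))]
        simp only [hψdef, d.2, if_false] }
  have hcard : Nat.card {d : Gs.ConnectedComponent // d ≠ c₂} + 1 =
      Nat.card Gs.ConnectedComponent := by
    have h := Set.ncard_add_ncard_compl ({c₂} : Set Gs.ConnectedComponent)
    rw [Set.ncard_singleton, ← Nat.card_coe_set_eq, add_comm] at h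
    exact h
  change Nat.card Gs.ConnectedComponent = Nat.card Gj.ConnectedComponent + 1
  rw [← hcard, Nat.card_congr e]

/-- **The joint/separate cluster-count identity** `k^{B₁,B₂}(ω) = k^{B₁∪B₂}(ω) + 1_{B₁ ↮ B₂}(ω)`
for nonempty arcs on a finite graph. [folklore] -/
theorem arcClusterCount_separate_eq [Finite V] {ω : Percolation.BondConfig V} {B₁ B₂ : Set V}
    (h₁ : B₁.Nonempty) (h₂ : B₂.Nonempty) [Decidable (ω ∈ arcCrossing B₁ B₂)] :
    arcClusterCount ω B₁ B₂ .separate =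
      arcClusterCount ω B₁ B₂ .joint + if ω ∈ arcCrossing B₁ B₂ then 0 else 1 := by
  split_ifs with hω
  · rw [arcClusterCount_separate_eq_joint_of_mem hω, add_zero]
  · obtain ⟨a, ha⟩ := h₁
    obtain ⟨c, hc⟩ := h₂
    exact arcClusterCount_separate_eq_joint_add_one_of_not_mem ha hc hω

/-! ### Polynomial form -/

variable [Fintype V] (G : SimpleGraph V) [DecidableRel G.Adj]

/-- On sub-events of the crossing event the restricted polynomials do not see the wiring:
`N^sep_{G,U} = N^joint_{G,U}` for `U ⊆ {B₁ ↔ B₂}`. [folklore] -/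
theorem rcArcPolynomialIn_separate_eq_joint {U : Set (Percolation.BondConfig V)} {B₁ B₂ : Set V}
    (hU : U ⊆ arcCrossing B₁ B₂) :
    rcArcPolynomialIn G U B₁ B₂ .separate = rcArcPolynomialIn G U B₁ B₂ .joint := by
  classical
  unfold rcArcPolynomialIn
  refine Finset.sum_congr (by congr!) fun ω hω => ?_
  rw [arcClusterCount_separate_eq_joint_of_mem (hU (Finset.mem_filter.1 hω).2)]

/-- **Polynomial form of the cluster-count identity**:
`Z^sep_G + X²·N_G = N_G + X²·Z^joint_G`, where `N_G` is the crossing-restricted polynomial (for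
either wiring), for nonempty arcs `B₁, B₂`. Evaluating at `t > 0` and dividing by `Z^sep(t)`:
`Z^joint/Z^sep = P_sep + (1 - P_sep)/t²` with `P_sep = N/Z^sep`. [folklore] -/
theorem rcArcPolynomial_separate_add {B₁ B₂ : Set V} (h₁ : B₁.Nonempty) (h₂ : B₂.Nonempty) :
    rcArcPolynomial G B₁ B₂ .separate + X ^ 2 * rcArcPolynomialIn G (arcCrossing B₁ B₂) B₁ B₂ .joint =
      rcArcPolynomialIn G (arcCrossing B₁ B₂) B₁ B₂ .joint + X ^ 2 * rcArcPolynomial G B₁ B₂ .joint := by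
  classical
  have hsplit : ∀ w, rcArcPolynomial G B₁ B₂ w =
      rcArcPolynomialIn G (arcCrossing B₁ B₂) B₁ B₂ w +
        ∑ ω ∈ G.edgeFinset.powerset.filter
          (fun ω : Finset (Sym2 V) => (↑ω : Percolation.BondConfig V) ∉ arcCrossing B₁ B₂),
          X ^ (#ω + 2 * arcClusterCount (↑ω : Percolation.BondConfig V) B₁ B₂ w) := fun w => by
    unfold rcArcPolynomial rcArcPolynomialIn
    rw [Finset.sum_filter_add_sum_filter_not]
  have hM : (∑ ω ∈ G.edgeFinset.powerset.filter
        (fun ω : Finset (Sym2 V) => (↑ω : Percolation.BondConfig V) ∉ arcCrossing B₁ B₂),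
        X ^ (#ω + 2 * arcClusterCount (↑ω : Percolation.BondConfig V) B₁ B₂ .separate) : ℕ[X]) =
      X ^ 2 * ∑ ω ∈ G.edgeFinset.powerset.filter
        (fun ω : Finset (Sym2 V) => (↑ω : Percolation.BondConfig V) ∉ arcCrossing B₁ B₂),
        X ^ (#ω + 2 * arcClusterCount (↑ω : Percolation.BondConfig V) B₁ B₂ .joint) := by
    rw [Finset.mul_sum]
    refine Finset.sum_congr rfl fun ω hω => ?_
    obtain ⟨a, ha⟩ := h₁
    obtain ⟨c, hc⟩ := h₂
    rw [arcClusterCount_separate_eq_joint_add_one_of_not_mem ha hc (Finset.mem_filter.1 hω).2,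
      ← pow_add]
    congr 1
    ring
  rw [hsplit .separate, hsplit .joint, rcArcPolynomialIn_separate_eq_joint G subset_rfl, hM]
  ring

end ClusterCountIdentity

/-! ### Planar form of the cluster-count identity -/

section PlanarIdentity

open SimpleGraph RandomPlanarGeometry

variable (R : ConformalRectangle) {δ : ℝ}

/-- An edge of a lifted configuration of `Ω_δ` has both endpoints in the discrete domain and
comes from an open edge of the subtype configuration. [cite: Smirnov2010, §2] -/
theorem openGraph_lift_adj_iff {Ω : Set ℂ} {δ : ℝ} {ω : Percolation.BondConfig (meshDomain Ω δ)}
    {x y : Site 2} :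
    (Percolation.openGraph (Sym2.map Subtype.val '' ω)).Adj x y ↔
      ∃ (hx : x ∈ meshDomain Ω δ) (hy : y ∈ meshDomain Ω δ),
        (Percolation.openGraph ω).Adj ⟨x, hx⟩ ⟨y, hy⟩ := by
  simp only [Percolation.openGraph_adj, Set.mem_image, ne_eq]
  constructor
  · rintro ⟨⟨e, he, hexy⟩, hne⟩
    induction e using Sym2.ind with
    | h u v =>
      rw [Sym2.map_mk, Sym2.eq_iff] at hexy
      rcases hexy with ⟨rfl, rfl⟩ | ⟨rfl, rfl⟩
      · exact ⟨u.2, v.2, by simpa using he, fun h => hne (congrArg Subtype.val h)⟩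
      · exact ⟨v.2, u.2, by rw [Sym2.eq_swap]; simpa using he,
          fun h => hne (congrArg Subtype.val h)⟩
  · rintro ⟨hx, hy, he, hne⟩
    exact ⟨⟨_, he, by simp⟩, fun h => hne (Subtype.ext h)⟩

/-- **The pulled-back crossing event is the intrinsic crossing event of `Ω_δ`**: for a
configuration `ω` of edges of `Ω_δ`, the lift of `ω` crosses `(Ω; (ab), (cd))` in Smirnov's sense
iff the discrete arcs `rectArc R δ 0`, `rectArc R δ 2` are joined by an open path of `ω`.
[cite: Smirnov2001, §2] -/
theorem mem_rectCrossing_iff {ω : Percolation.BondConfig (meshDomain R.carrier δ)}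
    (hω : ω ⊆ (domainSubgraph R.carrier δ).edgeSet) :
    ω ∈ rectCrossing R δ ↔ ω ∈ arcCrossing (rectArc R δ 0) (rectArc R δ 2) := by
  constructor
  · rintro ⟨x, hx, y, hy, hxy⟩
    -- lift the walk to the subtype
    have hxm : x ∈ meshDomain R.carrier δ :=
      meshBoundary_subset_meshDomain _ _ (discreteArc_subset_meshBoundary _ _ _ hx)
    suffices H : ∀ {u v : Site 2}, (Percolation.openGraph (Sym2.map Subtype.val '' ω) ⊓
        discreteDomainGraph R.carrier δ).Reachable u v → ∀ (hu : u ∈ meshDomain R.carrier δ),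
        ∃ hv : v ∈ meshDomain R.carrier δ, (Percolation.openGraph ω).Reachable ⟨u, hu⟩ ⟨v, hv⟩ by
      obtain ⟨hym, hr⟩ := H hxy hxm
      exact ⟨⟨x, hxm⟩, hx, ⟨y, hym⟩, hy, hr⟩
    intro u v huv
    obtain ⟨p⟩ := huv
    induction p with
    | nil => exact fun hu => ⟨hu, Reachable.rfl⟩
    | cons hadj _ ih =>
      intro hu
      obtain ⟨hu', hv', hadj'⟩ := openGraph_lift_adj_iff.1 hadj.1
      obtain ⟨hw, hr⟩ := ih hv'
      exact ⟨hw, hadj'.reachable.trans hr⟩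
  · rintro ⟨x, hx, y, hy, hxy⟩
    refine ⟨x, hx, y, hy, ?_⟩
    -- push the walk forward along `Subtype.val`
    refine hxy.map (G' := Percolation.openGraph (Sym2.map Subtype.val '' ω) ⊓
      discreteDomainGraph R.carrier δ) ⟨Subtype.val, fun {u v} huv => ⟨?_, ?_⟩⟩
    · exact openGraph_lift_adj_iff.2 ⟨u.2, v.2, huv⟩
    · have := hω ((Percolation.openGraph_adj _ _ _).1 huv).1
      exact this

/-- For `δ > 0` the crossing polynomial is the generic crossing-restricted polynomial of `Ω_δ`
(intrinsic crossing event `arcCrossing`). [cite: Smirnov2001, §2] -/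
theorem fkTwoArcCrossingPolynomial_eq_rcArcPolynomialIn (hδ : 0 < δ)
    [Fintype (meshDomain R.carrier δ)] (w : ArcWiring) :
    open scoped Classical in
    fkTwoArcCrossingPolynomial R δ w =
      rcArcPolynomialIn (domainSubgraph R.carrier δ) (arcCrossing (rectArc R δ 0) (rectArc R δ 2))
        (rectArc R δ 0) (rectArc R δ 2) w := by
  classical
  rw [fkTwoArcCrossingPolynomial_of_pos R hδ]
  unfold rcArcPolynomialIn
  refine Finset.sum_congr ?_ fun _ _ => rfl
  refine Finset.filter_congr fun ω hω => ?_
  refine mem_rectCrossing_iff R fun e he => ?_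
  exact SimpleGraph.mem_edgeFinset.1 (Finset.mem_powerset.1 hω he)

/-- **`N_δ` does not depend on the wiring** (crossing configurations have the same cluster count
under both wirings). [folklore] -/
theorem fkTwoArcCrossingPolynomial_separate_eq_joint :
    fkTwoArcCrossingPolynomial R δ .separate = fkTwoArcCrossingPolynomial R δ .joint := by
  classical
  rcases le_or_gt δ 0 with hδ | hδ
  · rw [fkTwoArcCrossingPolynomial_of_nonpos R hδ, fkTwoArcCrossingPolynomial_of_nonpos R hδ]
  · letI : Fintype (meshDomain R.carrier δ) := (meshDomain_finite R.isBounded hδ).fintype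
    rw [fkTwoArcCrossingPolynomial_eq_rcArcPolynomialIn R hδ,
      fkTwoArcCrossingPolynomial_eq_rcArcPolynomialIn R hδ,
      rcArcPolynomialIn_separate_eq_joint _ subset_rfl]

/-- **Planar cluster-count identity in polynomial form**: for `δ > 0` and nonempty discrete arcs
of `(ab)` and `(cd)`, `Z^sep_δ + X²·N_δ = N_δ + X²·Z^joint_δ`; at real `t > 0` this reads
`Z^joint_δ(t)/Z^sep_δ(t) = P^sep_δ(t) + (1 - P^sep_δ(t))/t²`, `P^sep_δ = N_δ/Z^sep_δ`. [folklore] -/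
theorem fkTwoArcPartitionPolynomials_separate_add (hδ : 0 < δ)
    (h0 : (discreteArc R.carrier δ (R.arc 0)).Nonempty)
    (h2 : (discreteArc R.carrier δ (R.arc 2)).Nonempty) :
    fkTwoArcPartitionPolynomials R δ .separate + X ^ 2 * fkTwoArcCrossingPolynomial R δ .joint =
      fkTwoArcCrossingPolynomial R δ .joint + X ^ 2 * fkTwoArcPartitionPolynomials R δ .joint := by
  classical
  letI : Fintype (meshDomain R.carrier δ) := (meshDomain_finite R.isBounded hδ).fintype
  have h0' : (rectArc R δ 0).Nonempty := by
    obtain ⟨x, hx⟩ := h0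
    exact ⟨⟨x, meshBoundary_subset_meshDomain _ _ (discreteArc_subset_meshBoundary _ _ _ hx)⟩, hx⟩
  have h2' : (rectArc R δ 2).Nonempty := by
    obtain ⟨x, hx⟩ := h2
    exact ⟨⟨x, meshBoundary_subset_meshDomain _ _ (discreteArc_subset_meshBoundary _ _ _ hx)⟩, hx⟩
  rw [fkTwoArcCrossingPolynomial_eq_rcArcPolynomialIn R hδ, fkTwoArcPartitionPolynomials_of_pos R hδ,
    fkTwoArcPartitionPolynomials_of_pos R hδ]
  exact rcArcPolynomial_separate_add _ h0' h2'

end PlanarIdentity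

end Literature.Probability.LatticeModels
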